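import Mathlib
import Summits.MatrixMultiplication.MatrixMultiplication.Theorems.SubgroupIdentityDesigns.Negative.FibreGhost

/-!
# Orbit-pair certificates: a design-exclusion engine for the `p`-free case (all `p`)

Route `LevelGradedCohnUmans`, crux `SubgroupIdentityDesigns`, the `(m,k) = (2,1)` cell.  After
`PMemberLaw` / `PThree` the cell is reduced (for `p ≥ 5`, `0 < ε ≤ 1`) to `p`-FREE subgroup TPP
triples, where the unitriangular cell laws are void.  This file gives the first all-`p` exclusion
engine for that case, with NO TPP and NO volume hypothesis:

* `sum_fourier_eq_of_orbit_pair`: a level-`1` function `F = Σ_{rk M ≤ 1} c_M ψ(tr(M·))` is a sum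
  of functions of one vector `g ↦ g a` (`exists_vecMulVec_of_rank_le_one`,
  `trace_vecMulVec_mul`), so if `k₀` preserves the multiset `{k a : k ∈ K}` for every `a ≠ 0`
  (an ORBIT PAIR `(K, k₀)`), then `Σ_{k ∈ K} F(k) = Σ_{k ∈ K} F(k₀ k)`;
* `no_levelOne_design_of_orbit_pair`: if moreover `1 ∈ K`, `k₀⁻¹ ∉ K`, and `K ∖ {1}`, `k₀ K`
  consist of triple products `a b g`, the level-`1` identity design of the crux is impossible
  (`1 = F(1) = Σ_K F = Σ_{k₀K} F = 0`); `…_mem₁/₂/₃`: the case `K ∪ k₀K ⊆ Hᵢ`.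

Intended instance (successor work, see the route folder `ORACLE-g14.md` §G14-17): `K` a subgroup
of a Singer cycle containing its norm-one subgroup `C_{p+1}` and `k₀` the Frobenius involution — e.g. any
member containing the dihedral group `O₂(𝔽_p) ⊇ SO₂(𝔽_p) ≅ C_{p+1}`; this kills the `p`-free
profiles observed above the floor at `p = 7`.  VALUE = THEOREM (engine), NOT summit progress; the
crux item stmt-MatrixMultiplication-14079 is untouched and remains open.
-/

set_option linter.dupNamespace false

noncomputable section

open scoped BigOperators Classical

open Summit.MatrixMultiplication.MatrixMultiplication.Theorems.LieRankDesigns.Negative (GLm Mat)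

namespace Summit.MatrixMultiplication.MatrixMultiplication.Theorems.SubgroupIdentityDesigns.Negative

section OrbitPair

variable {p : ℕ} [hp : Fact p.Prime]

/-- **Orbit pairs preserve level-one sums.**  If for every `a ≠ 0` the vectors `k₀ k a` (`k ∈ K`)
are a re-indexing of the vectors `k a`, then every level-`1` function has the same sum over `K` and
over `k₀ K`. -/
theorem sum_fourier_eq_of_orbit_pair (c : Mat p 2 → ℂ) (hc : ∀ M : Mat p 2, 1 < M.rank → c M = 0)
    (K : Finset (GLm p 2)) (k₀ : GLm p 2)
    (horb : ∀ a : Fin 2 → ZMod p, a ≠ 0 → ∃ e : K ≃ K, ∀ k : K,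
      ((k₀ * (e k : GLm p 2) : GLm p 2) : Mat p 2).mulVec a = ((k : GLm p 2) : Mat p 2).mulVec a) :
    ∑ k ∈ K, ∑ M : Mat p 2, c M * ZMod.stdAddChar (Matrix.trace (M * ((k : GLm p 2) : Mat p 2))) =
      ∑ k ∈ K, ∑ M : Mat p 2,
        c M * ZMod.stdAddChar (Matrix.trace (M * ((k₀ * k : GLm p 2) : Mat p 2))) := by
  rw [Finset.sum_comm, Finset.sum_comm (s := K)]
  refine Finset.sum_congr rfl fun M _ => ?_
  rw [← Finset.mul_sum, ← Finset.mul_sum]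
  by_cases hcM : c M = 0
  · rw [hcM, zero_mul, zero_mul]
  have hM : M.rank ≤ 1 := by
    by_contra h
    exact hcM (hc M (by omega))
  by_cases hM0 : M = 0
  · subst hM0
    simp
  obtain ⟨a, b, ha, rfl⟩ := exists_vecMulVec_of_rank_le_one M hM hM0
  congr 1
  simp_rw [trace_vecMulVec_mul]
  obtain ⟨e, he⟩ := horb a ha
  rw [← Finset.sum_coe_sort K, ← Finset.sum_coe_sort K]
  calc ∑ k : K, ZMod.stdAddChar (b ⬝ᵥ ((k : GLm p 2) : Mat p 2).mulVec a)
      = ∑ k : K, ZMod.stdAddChar (b ⬝ᵥ ((k₀ * (e k : GLm p 2) : GLm p 2) : Mat p 2).mulVec a) :=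
        Finset.sum_congr rfl fun k _ => by rw [he k]
    _ = ∑ k : K, ZMod.stdAddChar (b ⬝ᵥ ((k₀ * (k : GLm p 2) : GLm p 2) : Mat p 2).mulVec a) :=
        Equiv.sum_comp e (fun k : K =>
          ZMod.stdAddChar (b ⬝ᵥ ((k₀ * (k : GLm p 2) : GLm p 2) : Mat p 2).mulVec a))

/-- **NO LEVEL-ONE IDENTITY DESIGN IN THE PRESENCE OF AN ORBIT PAIR** supported on the triple
products: `1 ∈ K`, `k₀ k ≠ 1` on `K`, the elements of `K ∖ {1}` and of `k₀ K` are products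
`a b g` (`a ∈ H₁, b ∈ H₂, g ∈ H₃`), and `(K, k₀)` is an orbit pair.  All `p`; no TPP needed. -/
theorem no_levelOne_design_of_orbit_pair {H₁ H₂ H₃ : Subgroup (GLm p 2)} (K : Finset (GLm p 2))
    (k₀ : GLm p 2) (h1 : (1 : GLm p 2) ∈ K) (hk1 : ∀ k ∈ K, k₀ * k ≠ 1)
    (hmem : ∀ k ∈ K, k ≠ 1 → ∃ a ∈ H₁, ∃ b ∈ H₂, ∃ g ∈ H₃, a * b * g = k)
    (hmem' : ∀ k ∈ K, ∃ a ∈ H₁, ∃ b ∈ H₂, ∃ g ∈ H₃, a * b * g = k₀ * k)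
    (horb : ∀ a : Fin 2 → ZMod p, a ≠ 0 → ∃ e : K ≃ K, ∀ k : K,
      ((k₀ * (e k : GLm p 2) : GLm p 2) : Mat p 2).mulVec a = ((k : GLm p 2) : Mat p 2).mulVec a) :
    ¬ ∃ c : Mat p 2 → ℂ, (∀ M, 1 < M.rank → c M = 0) ∧
      (∑ M, c M * ZMod.stdAddChar (Matrix.trace (M * ((1 : GLm p 2) : Mat p 2)))) = 1 ∧
      ∀ a ∈ H₁, ∀ b ∈ H₂, ∀ g ∈ H₃, a * b * g ≠ 1 →
        (∑ M, c M *
          ZMod.stdAddChar (Matrix.trace (M * ((a * b * g : GLm p 2) : Mat p 2)))) = 0 := by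
  rintro ⟨c, hc, hc1, hc0⟩
  have hsum := sum_fourier_eq_of_orbit_pair c hc K k₀ horb
  have hL : ∑ k ∈ K, ∑ M : Mat p 2,
      c M * ZMod.stdAddChar (Matrix.trace (M * ((k : GLm p 2) : Mat p 2))) = 1 := by
    rw [Finset.sum_eq_single_of_mem 1 h1]
    · exact hc1
    · intro k hk hk1'
      obtain ⟨a, ha, b, hb, g, hg, e⟩ := hmem k hk hk1'
      rw [← e]
      exact hc0 a ha b hb g hg (by rw [e]; exact hk1')
  have hR : ∑ k ∈ K, ∑ M : Mat p 2,
      c M * ZMod.stdAddChar (Matrix.trace (M * ((k₀ * k : GLm p 2) : Mat p 2))) = 0 := by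
    refine Finset.sum_eq_zero fun k hk => ?_
    obtain ⟨a, ha, b, hb, g, hg, e⟩ := hmem' k hk
    rw [← e]
    exact hc0 a ha b hb g hg (by rw [e]; exact hk1 k hk)
  rw [hL, hR] at hsum
  exact one_ne_zero hsum

/-- The orbit pair inside the MIDDLE member: `K ⊆ H₂ ∋ k₀`. -/
theorem no_levelOne_design_of_orbit_pair_mem₂ {H₁ H₂ H₃ : Subgroup (GLm p 2)}
    (K : Finset (GLm p 2)) (k₀ : GLm p 2) (hK : ∀ k ∈ K, k ∈ H₂) (hk₀ : k₀ ∈ H₂)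
    (h1 : (1 : GLm p 2) ∈ K) (hk1 : ∀ k ∈ K, k₀ * k ≠ 1)
    (horb : ∀ a : Fin 2 → ZMod p, a ≠ 0 → ∃ e : K ≃ K, ∀ k : K,
      ((k₀ * (e k : GLm p 2) : GLm p 2) : Mat p 2).mulVec a = ((k : GLm p 2) : Mat p 2).mulVec a) :
    ¬ ∃ c : Mat p 2 → ℂ, (∀ M, 1 < M.rank → c M = 0) ∧
      (∑ M, c M * ZMod.stdAddChar (Matrix.trace (M * ((1 : GLm p 2) : Mat p 2)))) = 1 ∧
      ∀ a ∈ H₁, ∀ b ∈ H₂, ∀ g ∈ H₃, a * b * g ≠ 1 →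
        (∑ M, c M *
          ZMod.stdAddChar (Matrix.trace (M * ((a * b * g : GLm p 2) : Mat p 2)))) = 0 :=
  no_levelOne_design_of_orbit_pair K k₀ h1 hk1
    (fun k hk _ => ⟨1, H₁.one_mem, k, hK k hk, 1, H₃.one_mem, by rw [one_mul, mul_one]⟩)
    (fun k hk => ⟨1, H₁.one_mem, k₀ * k, H₂.mul_mem hk₀ (hK k hk), 1, H₃.one_mem,
      by rw [one_mul, mul_one]⟩) horb

/-- The orbit pair inside the FIRST member. -/
theorem no_levelOne_design_of_orbit_pair_mem₁ {H₁ H₂ H₃ : Subgroup (GLm p 2)}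
    (K : Finset (GLm p 2)) (k₀ : GLm p 2) (hK : ∀ k ∈ K, k ∈ H₁) (hk₀ : k₀ ∈ H₁)
    (h1 : (1 : GLm p 2) ∈ K) (hk1 : ∀ k ∈ K, k₀ * k ≠ 1)
    (horb : ∀ a : Fin 2 → ZMod p, a ≠ 0 → ∃ e : K ≃ K, ∀ k : K,
      ((k₀ * (e k : GLm p 2) : GLm p 2) : Mat p 2).mulVec a = ((k : GLm p 2) : Mat p 2).mulVec a) :
    ¬ ∃ c : Mat p 2 → ℂ, (∀ M, 1 < M.rank → c M = 0) ∧
      (∑ M, c M * ZMod.stdAddChar (Matrix.trace (M * ((1 : GLm p 2) : Mat p 2)))) = 1 ∧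
      ∀ a ∈ H₁, ∀ b ∈ H₂, ∀ g ∈ H₃, a * b * g ≠ 1 →
        (∑ M, c M *
          ZMod.stdAddChar (Matrix.trace (M * ((a * b * g : GLm p 2) : Mat p 2)))) = 0 :=
  no_levelOne_design_of_orbit_pair K k₀ h1 hk1
    (fun k hk _ => ⟨k, hK k hk, 1, H₂.one_mem, 1, H₃.one_mem, by rw [mul_one, mul_one]⟩)
    (fun k hk => ⟨k₀ * k, H₁.mul_mem hk₀ (hK k hk), 1, H₂.one_mem, 1, H₃.one_mem,
      by rw [mul_one, mul_one]⟩) horb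

/-- The orbit pair inside the LAST member. -/
theorem no_levelOne_design_of_orbit_pair_mem₃ {H₁ H₂ H₃ : Subgroup (GLm p 2)}
    (K : Finset (GLm p 2)) (k₀ : GLm p 2) (hK : ∀ k ∈ K, k ∈ H₃) (hk₀ : k₀ ∈ H₃)
    (h1 : (1 : GLm p 2) ∈ K) (hk1 : ∀ k ∈ K, k₀ * k ≠ 1)
    (horb : ∀ a : Fin 2 → ZMod p, a ≠ 0 → ∃ e : K ≃ K, ∀ k : K,
      ((k₀ * (e k : GLm p 2) : GLm p 2) : Mat p 2).mulVec a = ((k : GLm p 2) : Mat p 2).mulVec a) :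
    ¬ ∃ c : Mat p 2 → ℂ, (∀ M, 1 < M.rank → c M = 0) ∧
      (∑ M, c M * ZMod.stdAddChar (Matrix.trace (M * ((1 : GLm p 2) : Mat p 2)))) = 1 ∧
      ∀ a ∈ H₁, ∀ b ∈ H₂, ∀ g ∈ H₃, a * b * g ≠ 1 →
        (∑ M, c M *
          ZMod.stdAddChar (Matrix.trace (M * ((a * b * g : GLm p 2) : Mat p 2)))) = 0 :=
  no_levelOne_design_of_orbit_pair K k₀ h1 hk1
    (fun k hk _ => ⟨1, H₁.one_mem, 1, H₂.one_mem, k, hK k hk, by rw [one_mul, one_mul]⟩)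
    (fun k hk => ⟨1, H₁.one_mem, 1, H₂.one_mem, k₀ * k, H₃.mul_mem hk₀ (hK k hk),
      by rw [one_mul, one_mul]⟩) horb

end OrbitPair

end Summit.MatrixMultiplication.MatrixMultiplication.Theorems.SubgroupIdentityDesigns.Negative

end
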